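import Mathlib
import Literature.Computability.AlgebraicComplexity.PermanentIrreducible
import Literature.Computability.AlgebraicComplexity.StandardFamiliesProofs
import Summits.ValiantsHypothesis.ValiantsHypothesis.Theorems.DivisionGapPerCofactorDegreeReductionStubAdditiveCreation
import Summits.ValiantsHypothesis.ValiantsHypothesis.Theorems.DivisionGapPerCofactorDegreeReductionStubRelationComponents
import Summits.ValiantsHypothesis.ValiantsHypothesis.Theorems.DivisionGapPerCofactorDegreeReductionStubParityCofactor
import Summits.ValiantsHypothesis.ValiantsHypothesis.Theorems.PerCofactorDegreeReduction.Negative.TwoTowerStrict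

/-!
# Crux `DivisionGap.PerCofactorDegreeReduction` (stmt-ValiantsHypothesis-15046), line `Sketch` —
# stub `stub_twoSignedClassesExist`: two algebraically independent two-signed classes modulo
# the permanent exist for every `n ≥ 2`

**Theorem (`stub_twoSignedClassesExist`).**  Let `n ≥ 2` and split the permanent by the sign of
the permutation, over `ℝ≥0`: `per⁺ := Σ_{sign σ = 1} x^{μ_σ}`, `per⁻ := Σ_{sign σ = -1} x^{μ_σ}`
(`μ_σ` the exponent of `∏_i x_{σ i, i}`).  Then
* `per⁺ + per⁻ = per_n` (over `ℝ≥0`);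
* `per⁺ ≠ 0`, `per⁻ ≠ 0`, `deg per⁺ = deg per⁻ = n`;
* over `ℝ`, `per_n ∤ per⁺` and `per_n ∤ per⁻`;
* for cells `a ≠ b`, the real polynomials `x_a · per⁺` and `x_b · per⁺` are algebraically
  independent modulo `per_n`: if `per_n ∣ R(x_a per⁺, x_b per⁺)` for a real `R ∈ ℝ[y₀, y₁]`, then
  `R = 0`.

## Proof

* **Split.**  `sign σ ∈ {1, -1}` and `1 ≠ -1` in `ℤˣ` (`Int.units_ne_iff_eq_neg`), so the odd
  permutations are the non-even ones and `per_n = Σ_σ x^{μ_σ}` (`perPoly_eq_sum_monomial`) splits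
  (`Finset.sum_filter_add_sum_filter_not`) — verbatim the argument of
  `ParityCofactor.sum_even_add_sum_odd`, over an arbitrary commutative semiring.
* **Coefficients.**  `ρ ↦ μ_ρ` is injective (`permMonomial_injective`), so the coefficient of
  `Σ_{ρ ∈ S} x^{μ_ρ}` at `μ_σ` is `[σ ∈ S]` (`coeff_permMonomial_permSum`).  The identity is even
  and the transposition `(0 1)` (which needs `n ≥ 2`) is odd, so both halves are nonzero.
* **Degree.**  `deg μ_σ = n` (`PositivityThreshold.degree_permMonomial`), so each half is a form of
  degree `n` (`isHomogeneous_monomial`, `IsHomogeneous.sum`), and a nonzero form of degree `n` has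
  total degree `n` (`IsHomogeneous.totalDegree`).
* **Non-divisibility.**  If `Σ_{ρ ∈ S} x^{μ_ρ} = per_n · q` over the domain `ℝ` with `σ ∈ S`,
  `τ ∉ S`, then `q ≠ 0` and degrees add (`totalDegree_mul_of_isDomain`): `n = n + deg q`, so
  `q = C c` (`totalDegree_eq_zero_iff_eq_C`); the coefficient at `μ_τ` reads `0 = 1 · c`
  (`coeff_permMonomial_perPoly`), so `q = 0` — contradiction.
* **Independence.**  Let `P` be a real form of degree `e` with `per_n ∤ P`, `a ≠ b`, and suppose
  `per_n ∣ R(x_a P, x_b P)` with `R ≠ 0`.  Pick a monomial `d` of `R`, of degree `k`.  The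
  substituted gates `x_a P`, `x_b P` are forms of degree `1 + e`, so by
  `RelationComponents.stub_relationComponents` the permanent divides
  `R_D(x_a P, x_b P)` for the weighted component `R_D` of weight `D = (1+e)k` (weights
  `(1+e, 1+e)`), which is the ordinary homogeneous component `R_k ≠ 0` of degree `k`
  (`weightedHomogeneousComponent_const`).  For a form `S` of degree `k`,
  `S(x_a P, x_b P) = P^k · S(x_a, x_b)` (`aeval_mul_eq_pow_mul`, monomial by monomial).  The
  permanent is prime (`AdditiveCreation.perPoly_prime`) and does not divide `P`, hence not `P^k`,
  so it divides `T := R_k(x_a, x_b) = rename (0 ↦ a, 1 ↦ b) R_k`, which is nonzero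
  (`rename_injective`, `a ≠ b`) and misses every cell `v ∉ {a, b}` (`degreeOf_rename_eq_zero`);
  such a cell exists because `n² ≥ 4 > 2`.  But a nonzero multiple of `per_n` involves every
  variable (`PerCofactorDegreeReductionNegative.not_perPoly_dvd_of_degreeOf_eq_zero`) —
  contradiction.

Design: no definitions; the helper lemmas are stated for an arbitrary finite set `S` of
permutations (and the independence for an arbitrary real form `P ∉ (per_n)`), then specialised.
-/

noncomputable section

-- `Summit.ValiantsHypothesis.ValiantsHypothesis.…` is the tree's mandated single-conjunct layout
-- (Problem = Summit), so the duplicated namespace component is intended.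
set_option linter.dupNamespace false

namespace Summit.ValiantsHypothesis.ValiantsHypothesis.Theorems.DivisionGap.PerCofactorDegreeReduction.TwoSignedClassesExist

open MvPolynomial Literature.Computability.AlgebraicComplexity
open Summit.ValiantsHypothesis.ValiantsHypothesis.Theorems.DivisionGap.PerCofactorDegreeReduction.AdditiveCreation
  (perPoly_prime)
open Summit.ValiantsHypothesis.ValiantsHypothesis.Theorems.DivisionGap.PerCofactorDegreeReduction.RelationComponents
  (stub_relationComponents)
open Summit.ValiantsHypothesis.Theorems.PerCofactorDegreeReductionNegative
  (degreeOf_add_eq_zero degreeOf_mul_eq_zero not_perPoly_dvd_of_degreeOf_eq_zero)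
open scoped NNReal BigOperators

/-! ### Generic polynomial algebra -/

/-- For a positive constant weight `m`, the weighted homogeneous component of weight `m · k` is
the ordinary homogeneous component of degree `k`. [folklore] -/
theorem weightedHomogeneousComponent_const {σ R : Type*} [CommSemiring R] {m : ℕ} (hm : 0 < m)
    (k : ℕ) (p : MvPolynomial σ R) :
    weightedHomogeneousComponent (fun _ : σ => m) (m * k) p = homogeneousComponent k p := by
  ext d
  rw [coeff_weightedHomogeneousComponent, coeff_homogeneousComponent]
  have h : Finsupp.weight (fun _ : σ => m) d = m * d.degree := by
    rw [Finsupp.weight_apply, Finsupp.degree_apply, Finsupp.sum, Finset.mul_sum]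
    exact Finset.sum_congr rfl fun i _ => by rw [smul_eq_mul, mul_comm]
  rw [h]
  by_cases hk : d.degree = k
  · rw [if_pos hk, if_pos (by rw [hk])]
  · rw [if_neg hk, if_neg fun h' => hk (Nat.eq_of_mul_eq_mul_left hm h')]

/-- Substituting `f i · P` for the variables of a form `φ` of degree `k` gives
`P^k · φ(f)`. [folklore] -/
theorem aeval_mul_eq_pow_mul {σ τ R : Type*} [CommSemiring R] {φ : MvPolynomial σ R} {k : ℕ}
    (hφ : φ.IsHomogeneous k) (f : σ → MvPolynomial τ R) (P : MvPolynomial τ R) :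
    aeval (fun i => f i * P) φ = P ^ k * aeval f φ := by
  classical
  rw [φ.as_sum, map_sum, map_sum, Finset.mul_sum]
  refine Finset.sum_congr rfl fun d hd => ?_
  rw [aeval_monomial, aeval_monomial]
  simp only [Finsupp.prod, mul_pow, Finset.prod_mul_distrib, Finset.prod_pow_eq_pow_sum]
  rw [← hφ.degree_eq_sum_deg_support hd]
  ring

/-- Renaming along `f` produces a polynomial missing every variable outside the range of `f`.
[folklore] -/
theorem degreeOf_rename_eq_zero {σ τ R : Type*} [CommSemiring R] {f : σ → τ} {v : τ}
    (hv : ∀ i, f i ≠ v) (p : MvPolynomial σ R) : degreeOf v (rename f p) = 0 := by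
  induction p using MvPolynomial.induction_on with
  | C c => rw [rename_C, degreeOf_C]
  | add p q hp hq =>
    rw [map_add]
    exact degreeOf_add_eq_zero v hp hq
  | mul_X p i hp =>
    rw [map_mul, rename_X]
    exact degreeOf_mul_eq_zero v hp (degreeOf_X_of_ne (hv i).symm)

/-! ### Sums of permutation monomials -/

variable {n : ℕ}

section Semiring

variable {K : Type*} [CommSemiring K]

/-- The coefficient of `Σ_{ρ ∈ S} x^{μ_ρ}` at `μ_σ` is `[σ ∈ S]` (`ρ ↦ μ_ρ` is injective).
[folklore] -/
theorem coeff_permMonomial_permSum (S : Finset (Equiv.Perm (Fin n))) (σ : Equiv.Perm (Fin n)) :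
    coeff (permMonomial σ) (∑ ρ ∈ S, monomial (permMonomial ρ) (1 : K)) =
      if σ ∈ S then 1 else 0 := by
  classical
  simp only [coeff_sum, coeff_monomial, permMonomial_injective.eq_iff, Finset.sum_ite_eq']

/-- `Σ_{ρ ∈ S} x^{μ_ρ} ≠ 0` as soon as `S` is nonempty. [folklore] -/
theorem permSum_ne_zero [Nontrivial K] {S : Finset (Equiv.Perm (Fin n))} {σ : Equiv.Perm (Fin n)}
    (hσ : σ ∈ S) : (∑ ρ ∈ S, monomial (permMonomial ρ) (1 : K)) ≠ 0 := fun h => by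
  have := coeff_permMonomial_permSum (K := K) S σ
  rw [h, coeff_zero, if_pos hσ] at this
  exact zero_ne_one this

/-- `Σ_{ρ ∈ S} x^{μ_ρ}` is a form of degree `n` (`deg μ_ρ = n`). [folklore] -/
theorem permSum_isHomogeneous (S : Finset (Equiv.Perm (Fin n))) :
    (∑ ρ ∈ S, monomial (permMonomial ρ) (1 : K)).IsHomogeneous n :=
  IsHomogeneous.sum S _ n fun ρ _ =>
    isHomogeneous_monomial _ (PositivityThreshold.degree_permMonomial ρ)

/-- `Σ_{ρ ∈ S} x^{μ_ρ}` has total degree `n` as soon as `S` is nonempty. [folklore] -/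
theorem totalDegree_permSum [Nontrivial K] {S : Finset (Equiv.Perm (Fin n))}
    {σ : Equiv.Perm (Fin n)} (hσ : σ ∈ S) :
    (∑ ρ ∈ S, monomial (permMonomial ρ) (1 : K)).totalDegree = n :=
  (permSum_isHomogeneous S).totalDegree (permSum_ne_zero hσ)

/-- Base change of `Σ_{ρ ∈ S} x^{μ_ρ}` along a semiring map. [folklore] -/
theorem map_permSum {K' : Type*} [CommSemiring K'] (f : K →+* K')
    (S : Finset (Equiv.Perm (Fin n))) :
    MvPolynomial.map f (∑ ρ ∈ S, monomial (permMonomial ρ) (1 : K)) =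
      ∑ ρ ∈ S, monomial (permMonomial ρ) (1 : K') := by
  rw [map_sum]
  exact Finset.sum_congr rfl fun ρ _ => by rw [map_monomial, map_one]

variable (K) in
/-- `per_n = per⁺_n + per⁻_n` over any commutative semiring: every permutation is even or odd,
not both (`sign σ ∈ {±1}`, `1 ≠ −1` in `ℤˣ`); cf. `ParityCofactor.sum_even_add_sum_odd` over `ℝ`.
[folklore] -/
theorem sum_even_add_sum_odd :
    (∑ σ ∈ (Finset.univ : Finset (Equiv.Perm (Fin n))).filter
        (fun σ => Equiv.Perm.sign σ = 1), monomial (permMonomial σ) (1 : K)) +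
      ∑ σ ∈ (Finset.univ : Finset (Equiv.Perm (Fin n))).filter
        (fun σ => Equiv.Perm.sign σ = -1), monomial (permMonomial σ) (1 : K) =
      perPoly (Fin n) K := by
  have hO : (Finset.univ : Finset (Equiv.Perm (Fin n))).filter
      (fun σ => Equiv.Perm.sign σ = -1) =
      Finset.univ.filter (fun σ : Equiv.Perm (Fin n) => ¬Equiv.Perm.sign σ = 1) :=
    Finset.filter_congr fun σ _ => Int.units_ne_iff_eq_neg.symm
  rw [hO, Finset.sum_filter_add_sum_filter_not, perPoly_eq_sum_monomial]

end Semiring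

/-! ### Over `ℝ`: non-divisibility and independence -/

/-- A proper partial sum `Σ_{ρ ∈ S} x^{μ_ρ}` (`σ ∈ S`, `τ ∉ S`) is not a real multiple of
`per_n`: it has the same total degree `n` as `per_n`, so the cofactor would be a constant `c`,
and the coefficient at `μ_τ` gives `0 = c`. [folklore] -/
theorem not_perPoly_dvd_permSum {S : Finset (Equiv.Perm (Fin n))} {σ τ : Equiv.Perm (Fin n)}
    (hσ : σ ∈ S) (hτ : τ ∉ S) :
    ¬ perPoly (Fin n) ℝ ∣ ∑ ρ ∈ S, monomial (permMonomial ρ) (1 : ℝ) := by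
  rintro ⟨q, hq⟩
  have hq0 : q ≠ 0 := by
    rintro rfl
    exact permSum_ne_zero hσ (hq.trans (mul_zero _))
  have hper : (perPoly (Fin n) ℝ).totalDegree = n := by
    simpa using (perPoly_isHomogeneous (n := Fin n) (k := ℝ)).totalDegree (perPoly_ne_zero _ _)
  have hdeg : q.totalDegree = 0 := by
    have h := congr_arg totalDegree hq
    rw [totalDegree_permSum hσ, totalDegree_mul_of_isDomain (perPoly_ne_zero (Fin n) ℝ) hq0,
      hper] at h
    omega
  rw [totalDegree_eq_zero_iff_eq_C] at hdeg
  have hc := congr_arg (coeff (permMonomial τ)) hq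
  rw [coeff_permMonomial_permSum, if_neg hτ, hdeg, mul_comm, coeff_C_mul,
    coeff_permMonomial_perPoly, mul_one] at hc
  exact hq0 (by rw [hdeg, ← hc, C_0])

/-- **Independence of `x_a P` and `x_b P` modulo `per_n`.**  If `P` is a real form not divisible
by `per_n` (`n ≥ 2`) and `a ≠ b` are cells, then every real `R ∈ ℝ[y₀, y₁]` with
`per_n ∣ R(x_a P, x_b P)` vanishes: pass to a nonzero homogeneous component `R_k`
(`stub_relationComponents`), factor `R_k(x_a P, x_b P) = P^k · R_k(x_a, x_b)`, and use that
`per_n` is prime, does not divide `P`, and divides no nonzero polynomial in the two variables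
`x_a, x_b` only (`n² > 2` cells). [folklore] -/
theorem eq_zero_of_perPoly_dvd_aeval {e : ℕ} (hn : 2 ≤ n) {a b : Fin n × Fin n} (hab : a ≠ b)
    {P : MvPolynomial (Fin n × Fin n) ℝ} (hP : P.IsHomogeneous e)
    (hndvd : ¬ perPoly (Fin n) ℝ ∣ P) (R : MvPolynomial (Fin 2) ℝ)
    (hdvd : perPoly (Fin n) ℝ ∣ MvPolynomial.aeval ![X a * P, X b * P] R) : R = 0 := by
  classical
  by_contra hR
  have hprime : Prime (perPoly (Fin n) ℝ) := perPoly_prime (by omega)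
  -- the substituted gates are forms of degree `1 + e`
  have hA : (X a * P).IsHomogeneous (1 + e) := (isHomogeneous_X ℝ a).mul hP
  have hB : (X b * P).IsHomogeneous (1 + e) := (isHomogeneous_X ℝ b).mul hP
  -- a monomial `d` of `R`, of degree `k`; the homogeneous component `R_k ≠ 0`
  obtain ⟨d, hd⟩ := exists_coeff_ne_zero hR
  have hRk : homogeneousComponent d.degree R ≠ 0 := fun h => by
    have := congr_arg (coeff d) h
    rw [coeff_homogeneousComponent, if_pos rfl, coeff_zero] at this
    exact hd this
  -- `per_n ∣ R_k(x_a P, x_b P)`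
  have hW := stub_relationComponents n (1 + e) (1 + e) ((1 + e) * d.degree) (X a * P) (X b * P)
    hA hB R hdvd
  have hmm : (![1 + e, 1 + e] : Fin 2 → ℕ) = fun _ => 1 + e := by
    funext i
    fin_cases i <;> rfl
  have hfac : (![X a * P, X b * P] : Fin 2 → MvPolynomial (Fin n × Fin n) ℝ) =
      fun i => (![X a, X b] : Fin 2 → MvPolynomial (Fin n × Fin n) ℝ) i * P := by
    funext i
    fin_cases i <;> rfl
  rw [hmm, weightedHomogeneousComponent_const (by omega), hfac,
    aeval_mul_eq_pow_mul (homogeneousComponent_isHomogeneous _ R)] at hW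
  -- `per_n` is prime and does not divide `P ^ k`
  rcases hprime.dvd_or_dvd hW with h | h
  · exact hndvd (hprime.dvd_of_dvd_pow h)
  -- so it divides `T := R_k(x_a, x_b) = rename ![a, b] R_k ≠ 0`
  have hg : Function.Injective (![a, b] : Fin 2 → Fin n × Fin n) := by
    intro i j hij
    fin_cases i <;> fin_cases j
    · rfl
    · exact absurd hij hab
    · exact absurd hij.symm hab
    · rfl
  have hT : MvPolynomial.aeval (![X a, X b] : Fin 2 → MvPolynomial (Fin n × Fin n) ℝ)
      (homogeneousComponent d.degree R) = rename ![a, b] (homogeneousComponent d.degree R) := by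
    have : (![X a, X b] : Fin 2 → MvPolynomial (Fin n × Fin n) ℝ) = X ∘ ![a, b] := by
      funext i
      fin_cases i <;> rfl
    rw [this, rename_eq_aeval]
  rw [hT] at h
  have hT0 : rename ![a, b] (homogeneousComponent d.degree R) ≠ 0 := fun h0 =>
    hRk (rename_injective _ hg (by rw [h0, map_zero]))
  -- a cell `v ∉ {a, b}` (there are `n² ≥ 4` cells)
  obtain ⟨v, hv⟩ : (({a, b} : Finset (Fin n × Fin n))ᶜ).Nonempty := by
    rw [← Finset.card_pos, Finset.card_compl, Finset.card_pair hab, Fintype.card_prod,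
      Fintype.card_fin]
    have : 2 * 2 ≤ n * n := Nat.mul_le_mul hn hn
    omega
  rw [Finset.mem_compl, Finset.mem_insert, Finset.mem_singleton, not_or] at hv
  -- `T` misses `x_v`, hence is not a multiple of `per_n`
  refine not_perPoly_dvd_of_degreeOf_eq_zero hT0 v (degreeOf_rename_eq_zero (fun i => ?_) _) h
  fin_cases i
  · exact fun h' => hv.1 h'.symm
  · exact fun h' => hv.2 h'.symm

/-! ### The stub -/

/-- **stub_twoSignedClassesExist — TWO INDEPENDENT TWO-SIGNED CLASSES EXIST FOR EVERY `n ≥ 2`.**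
Split `per_n = per⁺ + per⁻` by the sign of the permutation, over `ℝ≥0`.  Both halves are nonzero
forms of degree `n` outside `(per_n)` (same degree as `per_n`, so divisibility would make them
`c · per_n`; compare the coefficient at a permutation of the other parity, which exists since
`n ≥ 2`).  For cells `a ≠ b` the classes of `x_a per⁺` and `x_b per⁺` are ALGEBRAICALLY
INDEPENDENT modulo `per_n`: if `R(x_a per⁺, x_b per⁺) ∈ (per_n)` for a real `R ≠ 0`, split
`R = Σ_k R_k` into forms; the summand `(per⁺)^k · R_k(x_a, x_b)` is the homogeneous component of
degree `k(n+1)` of the left side, so `per_n` (a form) divides each summand, hence — being prime —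
divides `per⁺` (impossible) or the nonzero polynomial `R_k(x_a, x_b)` in the two variables
`x_a, x_b` only (impossible: a nonzero multiple of `per_n` has positive degree in every one of the
`n² ≥ 4` variables). [folklore] -/
theorem stub_twoSignedClassesExist (n : ℕ) (hn : 2 ≤ n) (a b : Fin n × Fin n) (hab : a ≠ b)
    (Pp Pm : MvPolynomial (Fin n × Fin n) ℝ≥0)
    (hPp : Pp = ∑ σ ∈ (Finset.univ : Finset (Equiv.Perm (Fin n))).filter
      (fun σ => Equiv.Perm.sign σ = 1), monomial (permMonomial σ) 1)
    (hPm : Pm = ∑ σ ∈ (Finset.univ : Finset (Equiv.Perm (Fin n))).filter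
      (fun σ => Equiv.Perm.sign σ = -1), monomial (permMonomial σ) 1) :
    Pp + Pm = perPoly (Fin n) ℝ≥0 ∧ Pp ≠ 0 ∧ Pm ≠ 0 ∧
    Pp.totalDegree = n ∧ Pm.totalDegree = n ∧
    ¬ perPoly (Fin n) ℝ ∣ MvPolynomial.map NNReal.toRealHom Pp ∧
    ¬ perPoly (Fin n) ℝ ∣ MvPolynomial.map NNReal.toRealHom Pm ∧
    (∀ R : MvPolynomial (Fin 2) ℝ,
      perPoly (Fin n) ℝ ∣ MvPolynomial.aeval
        ![X a * MvPolynomial.map NNReal.toRealHom Pp, X b * MvPolynomial.map NNReal.toRealHom Pp] R →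
      R = 0) := by
  -- parities of `id` (even) and of the transposition `(0 1)` (odd; needs `n ≥ 2`)
  have h01 : (⟨0, by omega⟩ : Fin n) ≠ ⟨1, by omega⟩ := by
    rw [Ne, Fin.mk.injEq]
    omega
  have hu : (1 : ℤˣ) ≠ -1 := by decide
  have h1E : (1 : Equiv.Perm (Fin n)) ∈ (Finset.univ : Finset (Equiv.Perm (Fin n))).filter
      (fun σ => Equiv.Perm.sign σ = 1) :=
    Finset.mem_filter.2 ⟨Finset.mem_univ _, Equiv.Perm.sign_one⟩
  have hτE : Equiv.swap (⟨0, by omega⟩ : Fin n) ⟨1, by omega⟩ ∉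
      (Finset.univ : Finset (Equiv.Perm (Fin n))).filter (fun σ => Equiv.Perm.sign σ = 1) :=
    fun h => hu ((Finset.mem_filter.1 h).2.symm.trans (Equiv.Perm.sign_swap h01))
  have hτO : Equiv.swap (⟨0, by omega⟩ : Fin n) ⟨1, by omega⟩ ∈
      (Finset.univ : Finset (Equiv.Perm (Fin n))).filter (fun σ => Equiv.Perm.sign σ = -1) :=
    Finset.mem_filter.2 ⟨Finset.mem_univ _, Equiv.Perm.sign_swap h01⟩
  have h1O : (1 : Equiv.Perm (Fin n)) ∉
      (Finset.univ : Finset (Equiv.Perm (Fin n))).filter (fun σ => Equiv.Perm.sign σ = -1) :=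
    fun h => hu (Equiv.Perm.sign_one.symm.trans (Finset.mem_filter.1 h).2)
  subst hPp hPm
  refine ⟨sum_even_add_sum_odd ℝ≥0, permSum_ne_zero h1E, permSum_ne_zero hτO,
    totalDegree_permSum h1E, totalDegree_permSum hτO, ?_, ?_, fun R hR => ?_⟩
  · rw [map_permSum]
    exact not_perPoly_dvd_permSum h1E hτE
  · rw [map_permSum]
    exact not_perPoly_dvd_permSum hτO h1O
  · rw [map_permSum] at hR
    exact eq_zero_of_perPoly_dvd_aeval hn hab (permSum_isHomogeneous _)
      (not_perPoly_dvd_permSum h1E hτE) R hR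

end Summit.ValiantsHypothesis.ValiantsHypothesis.Theorems.DivisionGap.PerCofactorDegreeReduction.TwoSignedClassesExist

end
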